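import Summits.PneNP.PneNP.Theorems.SingleThreshold.Negative.LoadBearing
import Literature.Computability.Complexity.RossmanMonotoneCliqueApprox
import Literature.Computability.Complexity.RossmanMonotoneCliqueGraphs
import Literature.Computability.Complexity.NegationElimination

/-!
# The exact clique minterm descends to a split (Rossman 2010, Observation 7 / Lemma 14)

Route `OneSlice`, crux `Summit.PneNP.PneNP.Theses.OneSlice.SingleThreshold` (stmt-PneNP-2833), line
`two-round-exposure`: the registered stub `stub_exactCliqueDescent` (deterministic, pure
combinatorics).

Setting: a well-formed straight-line program `gs` over `{∧₂, ∨₂}` on the edges of `K_n`, and wire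
approximators `ap` in the structural ⋆-closed form of Rossman (FOCS 2010, §5.2): input wires are
exact (`ap (inl i) = (· i)`), an `∧`-gate is the exact conjunction of the approximators of its
children, an `∨`-gate is the ⋆-closure `starClosure p t (smallI n k ∪ medJ n k)` of the disjunction
of the approximators of its children. Fix a background graph `x` (the sparse noise `S`) and a
`k`-set `A`, `k ≥ 3`, and write `F_w := fun y => ap w (x ⊔ y)` for the SHIFTED approximator of the
wire `w`.

**What.** `stub_exactCliqueDescent`: if the clique `K_A = cliqueVec A` is an exact minterm of
`F_out`, then there is a descent `out = w 0, w 1, …, w r` through the program (each `w (i+1)` a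
child of the gate `w i`) along which `K_A` stays an exact minterm of every `F_{w i}`, ending at an
`∧`-gate `w r = u ∧ v` where `K_A` is an exact minterm of NEITHER `F_u` nor `F_v` (a split).

**How** (Rossman 2010, Observation 7 and the proof of Lemma 14, shifted by the background `x`).
* Input wires never carry the clique minterm (`not_isMinterm_inl_shift`): `F_{inl i} y = x i || y i`
  is constant (`x i = 1`, but `⊥ < K_A`) or the variable `y i` whose only minterm is the single
  edge `indVec {i}` (`isMinterm_apply_iff`), and `K_A` has `k ≥ 3` non-isolated vertices.
* The new point, `∨̄`-gates pass the EXACT clique minterm for free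
  (`isMinterm_shift_starClosure`, `not_cliqueVec_le_of_mem`): a minterm `m₀` of the shifted
  closure `y ↦ f⋆(x ⊔ y)` is a minterm of `y ↦ f (x ⊔ y)` or lies below a closure-added pattern
  `h ∈ smallI ∪ medJ` (take `y = m₀ ⊓ h` in the indicator `Ind_h (x ⊔ y)`); but such `h` has at
  most `k - 1` non-isolated vertices (`mem_smallI`, `medJ_ineq`), fewer than `supp K_A = A`.
  Hence at an `∨`-gate `K_A` is a minterm of `F_u ∨ F_v`, so of `F_u` or `F_v`
  (`IsMinterm.of_or`), and the descent continues.
* At an `∧`-gate the descent continues into a child carrying `K_A`, or stops (split).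
The recursion is a strong induction on the position of the wire (`descent_aux`, children of the
gate at position `m` of a well-formed program are valid below `m`), the bookkeeping of prepending
a gate to a descent being `descent_cons`.

## References

* B. Rossman, *The monotone complexity of k-clique on random graphs*, FOCS 2010 (full version
  2009), §2 and Observation 7 (p. 6), §5.2 with Lemma 14 (p. 8) [Rossman2010].
-/

noncomputable section

set_option linter.dupNamespace false

open Finset

open scoped Classical

namespace Summit.PneNP.PneNP.Theorems.SingleThreshold

open Literature.Computability.Complexity GateList
open Summit.PneNP.PneNP.Theorems.SingleThreshold.Negative (Edges)

/-! ### Minterms of a shifted ⋆-closure -/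

section Shift

variable {ι : Type*} [Fintype ι] [DecidableEq ι]

/-- **One shifted closure round.** A minterm `m₀` of `y ↦ (g ∨ ⋁_{h ∈ clAdd} Ind_h) (x ⊔ y)` is a
minterm of `y ↦ g (x ⊔ y)` or lies below an added pattern `h ∈ K`: if the indicator part fires at
`x ⊔ m₀` through `h ≤ x ⊔ m₀`, it already fires at `x ⊔ (m₀ ⊓ h)`, so minimality of `m₀` forces
`m₀ ⊓ h = m₀`. (Rossman 2010, Lemma 12, shifted by a background graph.)
[cite: Rossman2010, Lemma 12 (p. 7)] -/
theorem isMinterm_shift_clStep (p t : ℝ) (K : Finset (ι → Bool)) (g : (ι → Bool) → Bool)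
    (x : ι → Bool) {m₀ : ι → Bool} (hm : IsMinterm (fun y => clStep p t K g (x ⊔ y)) m₀) :
    IsMinterm (fun y => g (x ⊔ y)) m₀ ∨ ∃ h ∈ K, m₀ ≤ h := by
  rcases hm.of_or with h1 | h2
  · exact Or.inl h1
  · obtain ⟨h21, -⟩ := id h2
    rw [decide_eq_true_eq] at h21
    obtain ⟨h, hS, hsub⟩ := h21
    have hle : h ≤ x ⊔ m₀ := (le_iff_onSet_subset _ _).2 hsub
    have hy : h ≤ x ⊔ m₀ ⊓ h := by
      rw [sup_inf_left]
      exact le_inf hle le_sup_right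
    have heq : m₀ ⊓ h = m₀ := h2.eq_of_le inf_le_left (by
      rw [decide_eq_true_eq]
      exact ⟨h, hS, (le_iff_onSet_subset _ _).1 hy⟩)
    exact Or.inr ⟨h, mem_of_mem_filter h hS, inf_eq_left.1 heq⟩

/-- **Finitely many shifted closure rounds**: a minterm of `y ↦ (clIter f N) (x ⊔ y)` is a minterm
of `y ↦ f (x ⊔ y)` or lies below a pattern of `K`. [cite: Rossman2010, Lemma 12 (p. 7)] -/
theorem isMinterm_shift_clIter (p t : ℝ) (K : Finset (ι → Bool)) (f : (ι → Bool) → Bool)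
    (x : ι → Bool) {m₀ : ι → Bool} (N : ℕ)
    (hm : IsMinterm (fun y => clIter p t K f N (x ⊔ y)) m₀) :
    IsMinterm (fun y => f (x ⊔ y)) m₀ ∨ ∃ h ∈ K, m₀ ≤ h := by
  induction N with
  | zero => exact Or.inl hm
  | succ N ih =>
    rcases isMinterm_shift_clStep p t K (clIter p t K f N) x hm with h | h
    · exact ih h
    · exact Or.inr h

/-- **Minterms of a shifted ⋆-closure** (Rossman 2010, Lemma 12 `M(f⋆) ⊆ M(f) ∪ K`, shifted by a
background graph `x`): a minterm `m₀` of `y ↦ f⋆ (x ⊔ y)` is a minterm of `y ↦ f (x ⊔ y)` or lies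
below some `h ∈ K`. [cite: Rossman2010, Lemma 12 (p. 7)] -/
theorem isMinterm_shift_starClosure (p t : ℝ) (K : Finset (ι → Bool)) (f : (ι → Bool) → Bool)
    (x : ι → Bool) {m₀ : ι → Bool}
    (hm : IsMinterm (fun y => starClosure p t K f (x ⊔ y)) m₀) :
    IsMinterm (fun y => f (x ⊔ y)) m₀ ∨ ∃ h ∈ K, m₀ ≤ h :=
  isMinterm_shift_clIter p t K f x (#K + 1) hm

end Shift

/-! ### The clique vector against input wires and small patterns -/

variable {n : ℕ}

/-- `K_A` is not the empty graph when `|A| ≥ 3`. [folklore] -/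
theorem bot_lt_cliqueVec {A : Finset (Fin n)} (hA : 3 ≤ #A) :
    (⊥ : Edges n → Bool) < cliqueVec A := by
  obtain ⟨u, hu⟩ : A.Nonempty := card_pos.1 (by omega)
  have hu' : u ∈ supp (cliqueVec A) := by
    rw [supp_cliqueVec (by omega)]
    exact hu
  rw [mem_supp] at hu'
  obtain ⟨e, he, -⟩ := hu'
  rw [lt_iff_onSet_ssubset, onSet_bot, Finset.empty_ssubset]
  exact ⟨e, (mem_onSet _ _).2 he⟩

/-- `K_A` is not a single edge when `|A| ≥ 3` (it has `|A|` non-isolated vertices, an edge has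
two). [folklore] -/
theorem cliqueVec_ne_indVec_singleton {A : Finset (Fin n)} (hA : 3 ≤ #A) (e : Edges n) :
    cliqueVec A ≠ indVec {e} := by
  intro h
  have h1 : #(supp (cliqueVec A)) = #A := by rw [supp_cliqueVec (by omega)]
  rw [h, supp_indVec_singleton, card_endpts] at h1
  omega

/-- **Input wires never carry the exact clique minterm** (`|A| ≥ 3`): the shifted variable
`y ↦ (x ⊔ y) i` is constantly `1` if `x i = 1` (but `⊥ < K_A`), and is the variable `y i`, whose
only minterm is the single edge `i`, if `x i = 0`.
[cite: Rossman2010, Lemma 14 (p. 8), base case] -/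
theorem not_isMinterm_inl_shift {A : Finset (Fin n)} (hA : 3 ≤ #A) (x : Edges n → Bool)
    (i : Edges n) : ¬ IsMinterm (fun y => (x ⊔ y) i) (cliqueVec A) := by
  intro hm
  have h0 : (x ⊔ ⊥) i = false := hm.2 ⊥ (bot_lt_cliqueVec hA)
  rw [sup_bot_eq] at h0
  have hfun : (fun y : Edges n → Bool => (x ⊔ y) i) = fun y => y i := by
    funext y
    change (x i || y i) = y i
    rw [h0, Bool.false_or]
  rw [hfun, isMinterm_apply_iff] at hm
  exact cliqueVec_ne_indVec_singleton hA i hm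

/-- **Closure-added patterns cannot carry the clique**: every `h ∈ smallI ∪ medJ` has at most
`k - 1` non-isolated vertices (`2·supp h < k`, resp. `supp h + 1 ≤ k` by `medJ_ineq`), while
`K_A ≤ h` would force `A = supp K_A ⊆ supp h`, `|A| = k`. [cite: Rossman2010, §5–§6 (pp. 6, 9)] -/
theorem not_cliqueVec_le_of_mem {k : ℕ} (hk : 3 ≤ k) {A : Finset (Fin n)} (hA : #A = k)
    {h : Edges n → Bool} (hK : h ∈ smallI n k ∪ medJ n k) : ¬ cliqueVec A ≤ h := by
  intro hle
  have hsub := supp_mono hle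
  rw [supp_cliqueVec (by omega)] at hsub
  have hcard := card_le_card hsub
  rw [hA] at hcard
  rcases mem_union.1 hK with hI | hJ
  · rw [mem_smallI] at hI
    omega
  · have := (medJ_ineq hJ).2.1
    omega

/-! ### Descents -/

/-- **Prepending a gate to a descent.** If the gate at position `m` (an `andGate u v` or an
`orGate u v`) carries the shifted minterm `K₀` and one of its children `c ∈ {u, v}` starts a
descent ending at a split, then so does `inr m` (shift the chain by one). [folklore] -/
theorem descent_cons {α : Type*} {gs : List (Gate α)} {ap : α ⊕ ℕ → (α → Bool) → Bool}
    {x K₀ : α → Bool} {m : ℕ} {u v c : α ⊕ ℕ}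
    (hg : gs[m]? = some (andGate u v) ∨ gs[m]? = some (orGate u v)) (hc : c = u ∨ c = v)
    (hPm : IsMinterm (fun y => ap (Sum.inr m) (x ⊔ y)) K₀)
    (h : ∃ (r m₁ : ℕ) (u₁ v₁ : α ⊕ ℕ) (w : ℕ → α ⊕ ℕ),
      w 0 = c ∧ w r = Sum.inr m₁ ∧ gs[m₁]? = some (andGate u₁ v₁) ∧
      (∀ i, i < r → ∃ (m' : ℕ) (u' v' : α ⊕ ℕ), w i = Sum.inr m' ∧
          (gs[m']? = some (andGate u' v') ∨ gs[m']? = some (orGate u' v')) ∧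
          (w (i + 1) = u' ∨ w (i + 1) = v')) ∧
      (∀ i, i ≤ r → IsMinterm (fun y => ap (w i) (x ⊔ y)) K₀) ∧
      ¬ IsMinterm (fun y => ap u₁ (x ⊔ y)) K₀ ∧
      ¬ IsMinterm (fun y => ap v₁ (x ⊔ y)) K₀) :
    ∃ (r m₁ : ℕ) (u₁ v₁ : α ⊕ ℕ) (w : ℕ → α ⊕ ℕ),
      w 0 = Sum.inr m ∧ w r = Sum.inr m₁ ∧ gs[m₁]? = some (andGate u₁ v₁) ∧
      (∀ i, i < r → ∃ (m' : ℕ) (u' v' : α ⊕ ℕ), w i = Sum.inr m' ∧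
          (gs[m']? = some (andGate u' v') ∨ gs[m']? = some (orGate u' v')) ∧
          (w (i + 1) = u' ∨ w (i + 1) = v')) ∧
      (∀ i, i ≤ r → IsMinterm (fun y => ap (w i) (x ⊔ y)) K₀) ∧
      ¬ IsMinterm (fun y => ap u₁ (x ⊔ y)) K₀ ∧
      ¬ IsMinterm (fun y => ap v₁ (x ⊔ y)) K₀ := by
  obtain ⟨r, m₁, u₁, v₁, w, rfl, hwr, hg₁, hchain, hP, hQu, hQv⟩ := h
  refine ⟨r + 1, m₁, u₁, v₁, fun i => match i with | 0 => Sum.inr m | j + 1 => w j,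
    rfl, hwr, hg₁, ?_, ?_, hQu, hQv⟩
  · intro i hi
    cases i with
    | zero => exact ⟨m, u, v, rfl, hg, hc⟩
    | succ j => exact hchain j (Nat.lt_of_succ_lt_succ hi)
  · intro i hi
    cases i with
    | zero => exact hPm
    | succ j => exact hP j (Nat.le_of_succ_le_succ hi)

/-- **The descent, by strong induction on the position of the starting wire.** For wires valid
below `N` (and below `gs.length`): input wires are contradictory (`not_isMinterm_inl_shift`); at a
gate `inr m` over `monotoneBasis` (an `andGate` or an `orGate`, children valid below `m` by
well-formedness) the clique minterm either splits (`∧`, neither child carries it: stop) or is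
carried by a child (always at an `∨̄`-gate, by `isMinterm_shift_starClosure`,
`not_cliqueVec_le_of_mem` and `IsMinterm.of_or`), where the induction hypothesis applies and the
gate is prepended (`descent_cons`). [cite: Rossman2010, Observation 7 (p. 6) and Lemma 14 (p. 8)] -/
theorem descent_aux {n k : ℕ} (hk : 3 ≤ k) {p t : ℝ}
    (gs : List (Gate (Edges n))) (ap : Edges n ⊕ ℕ → (Edges n → Bool) → Bool)
    (hwf : GateList.WF gs) (hB : ∀ g ∈ gs, g.fn ∈ monotoneBasis)
    (hinl : ∀ i, ap (Sum.inl i) = fun x => x i)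
    (hor : ∀ (m : ℕ) (u v : Edges n ⊕ ℕ), gs[m]? = some (GateList.orGate u v) →
        ap (Sum.inr m) = starClosure p t (smallI n k ∪ medJ n k) (fun x => ap u x || ap v x))
    (x : Edges n → Bool) (A : Finset (Fin n)) (hA : #A = k) (N : ℕ) :
    ∀ out : Edges n ⊕ ℕ, GateList.OutOK gs.length out → GateList.OutOK N out →
      IsMinterm (fun y => ap out (x ⊔ y)) (cliqueVec A) →
    ∃ (r m : ℕ) (u v : Edges n ⊕ ℕ) (w : ℕ → Edges n ⊕ ℕ),
      w 0 = out ∧ w r = Sum.inr m ∧ gs[m]? = some (GateList.andGate u v) ∧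
      (∀ i, i < r → ∃ (m' : ℕ) (u' v' : Edges n ⊕ ℕ), w i = Sum.inr m' ∧
          (gs[m']? = some (GateList.andGate u' v') ∨ gs[m']? = some (GateList.orGate u' v')) ∧
          (w (i + 1) = u' ∨ w (i + 1) = v')) ∧
      (∀ i, i ≤ r → IsMinterm (fun y => ap (w i) (x ⊔ y)) (cliqueVec A)) ∧
      ¬ IsMinterm (fun y => ap u (x ⊔ y)) (cliqueVec A) ∧
      ¬ IsMinterm (fun y => ap v (x ⊔ y)) (cliqueVec A) := by
  have hA3 : 3 ≤ #A := by omega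
  -- input wires never carry the clique minterm
  have hinput : ∀ i, ¬ IsMinterm (fun y => ap (Sum.inl i) (x ⊔ y)) (cliqueVec A) := fun i => by
    rw [hinl i]
    exact not_isMinterm_inl_shift hA3 x i
  induction N with
  | zero =>
    rintro (i | m) hout hN hmin
    · exact absurd hmin (hinput i)
    · exact absurd (hN m rfl) (Nat.not_lt_zero m)
  | succ N ih =>
    rintro (i | m) hout hN hmin
    · exact absurd hmin (hinput i)
    · have hml : m < gs.length := hout m rfl
      have hmN : m < N + 1 := hN m rfl
      obtain ⟨g, hg⟩ : ∃ g, gs[m]? = some g := ⟨gs[m], List.getElem?_eq_getElem hml⟩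
      have hgOK : GateOK m g := hwf m g hg
      have hgB := hB g (List.mem_of_getElem? hg)
      -- children of the gate at position `m` are valid below `m`, hence below `gs.length` and `N`
      have hlen : ∀ c : Edges n ⊕ ℕ, OutOK m c → OutOK gs.length c := fun c hc n' hn' =>
        (hc n' hn').trans hml
      have hbd : ∀ c : Edges n ⊕ ℕ, OutOK m c → OutOK N c := fun c hc n' hn' =>
        Nat.lt_of_lt_of_le (hc n' hn') (Nat.le_of_lt_succ hmN)
      simp only [monotoneBasis, Set.mem_insert_iff, Set.mem_singleton_iff] at hgB
      rcases hgB with hc | hc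
      · -- an `∧`-gate: descend into a child carrying the clique minterm, or split here
        obtain ⟨u, v, rfl⟩ := exists_eq_andGate_of_fn_eq hc
        have hu : OutOK m u := fun n' hn' => hgOK (0 : Fin 2) n' hn'
        have hv : OutOK m v := fun n' hn' => hgOK (1 : Fin 2) n' hn'
        by_cases hmu : IsMinterm (fun y => ap u (x ⊔ y)) (cliqueVec A)
        · exact descent_cons (Or.inl hg) (Or.inl rfl) hmin (ih u (hlen u hu) (hbd u hu) hmu)
        · by_cases hmv : IsMinterm (fun y => ap v (x ⊔ y)) (cliqueVec A)
          · exact descent_cons (Or.inl hg) (Or.inr rfl) hmin (ih v (hlen v hv) (hbd v hv) hmv)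
          · exact ⟨0, m, u, v, fun _ => Sum.inr m, rfl, rfl, hg,
              fun i hi => absurd hi (Nat.not_lt_zero i), fun i _ => hmin, hmu, hmv⟩
      · -- an `∨̄`-gate: the exact clique minterm passes to a child
        obtain ⟨u, v, rfl⟩ := exists_eq_orGate_of_fn_eq hc
        have hu : OutOK m u := fun n' hn' => hgOK (0 : Fin 2) n' hn'
        have hv : OutOK m v := fun n' hn' => hgOK (1 : Fin 2) n' hn'
        have hcl : IsMinterm (fun y => starClosure p t (smallI n k ∪ medJ n k)
            (fun z => ap u z || ap v z) (x ⊔ y)) (cliqueVec A) := by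
          rw [hor m u v hg] at hmin
          exact hmin
        have huv : IsMinterm (fun y => ap u (x ⊔ y) || ap v (x ⊔ y)) (cliqueVec A) := by
          rcases isMinterm_shift_starClosure p t _ _ x hcl with h | ⟨h, hK, hle⟩
          · exact h
          · exact absurd hle (not_cliqueVec_le_of_mem hk hA hK)
        rcases huv.of_or with hmu | hmv
        · exact descent_cons (Or.inr hg) (Or.inl rfl) hmin (ih u (hlen u hu) (hbd u hu) hmu)
        · exact descent_cons (Or.inr hg) (Or.inr rfl) hmin (ih v (hlen v hv) (hbd v hv) hmv)

/-- **The exact clique minterm descends to a split** (Rossman 2010, Observation 7 and Lemma 14,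
shifted by the background graph; stub `stub_exactCliqueDescent` of line `two-round-exposure`).
For the structural approximators `ap` of a well-formed `{∧₂, ∨₂}`-program `gs` (inputs exact, `∧`
exact, `∨ ↦` the ⋆-closure of the disjunction w.r.t. `smallI n k ∪ medJ n k`), a background `x`
and a `k`-set `A` (`k ≥ 3`): if `K_A` is an exact minterm of the shifted output
`y ↦ ap out (x ⊔ y)`, then there is a descent `out = w 0, …, w r` (each `w (i+1)` a child of the
gate `w i`) along which `K_A` stays an exact minterm of every shifted approximator, ending at an
`∧`-gate `w r = u ∧ v` at which `K_A` is an exact shifted minterm of neither child. Input wires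
never carry `K_A` (`not_isMinterm_inl_shift`), `∨̄`-gates pass it to a child
(`isMinterm_shift_starClosure`: closure-added patterns have fewer than `k` non-isolated
vertices), `∧`-gates pass it or split (`descent_aux`).
[cite: Rossman2010, Observation 7 (p. 6) and Lemma 14 (p. 8)] -/
theorem stub_exactCliqueDescent {n k : ℕ} (hk : 3 ≤ k) {p t : ℝ}
    (gs : List (Gate (Edges n))) (ap : Edges n ⊕ ℕ → (Edges n → Bool) → Bool)
    (hwf : GateList.WF gs) (hB : ∀ g ∈ gs, g.fn ∈ monotoneBasis)
    (hinl : ∀ i, ap (Sum.inl i) = fun x => x i)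
    (hand : ∀ (m : ℕ) (u v : Edges n ⊕ ℕ), gs[m]? = some (GateList.andGate u v) →
        ap (Sum.inr m) = fun x => ap u x && ap v x)
    (hor : ∀ (m : ℕ) (u v : Edges n ⊕ ℕ), gs[m]? = some (GateList.orGate u v) →
        ap (Sum.inr m) = starClosure p t (smallI n k ∪ medJ n k) (fun x => ap u x || ap v x))
    (hmono : ∀ w, GateList.OutOK gs.length w → Monotone (ap w))
    (x : Edges n → Bool) (A : Finset (Fin n)) (hA : #A = k)
    (out : Edges n ⊕ ℕ) (hout : GateList.OutOK gs.length out)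
    (hmin : IsMinterm (fun y => ap out (x ⊔ y)) (cliqueVec A)) :
    ∃ (r m : ℕ) (u v : Edges n ⊕ ℕ) (w : ℕ → Edges n ⊕ ℕ),
      w 0 = out ∧ w r = Sum.inr m ∧ gs[m]? = some (GateList.andGate u v) ∧
      (∀ i, i < r → ∃ (m' : ℕ) (u' v' : Edges n ⊕ ℕ), w i = Sum.inr m' ∧
          (gs[m']? = some (GateList.andGate u' v') ∨ gs[m']? = some (GateList.orGate u' v')) ∧
          (w (i + 1) = u' ∨ w (i + 1) = v')) ∧
      (∀ i, i ≤ r → IsMinterm (fun y => ap (w i) (x ⊔ y)) (cliqueVec A)) ∧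
      ¬ IsMinterm (fun y => ap u (x ⊔ y)) (cliqueVec A) ∧
      ¬ IsMinterm (fun y => ap v (x ⊔ y)) (cliqueVec A) := by
  -- the `∧`-clause `hand` and monotonicity `hmono` are part of the registered interface of the
  -- stub (the needle consumes them) but are not needed for the descent itself
  have _ := hand
  have _ := hmono
  exact descent_aux hk gs ap hwf hB hinl hor x A hA gs.length out hout hout hmin

end Summit.PneNP.PneNP.Theorems.SingleThreshold
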